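import Summits.QuantumFields.QCD.Theses.SpectralDefectExtinction
import Summits.QuantumFields.QCD.Theorems.SpectralDefectExtinctionChiralDescentInfimumDescent

/-!
# `ChiralDescent` (crux stmt-QuantumFields-17527) — the residual content in its three equivalent promotable forms
# (line `Sketch`, continuation lead c2, cycle 3, 2026-08-17)

The infimum descent (landed `SpectralDefectExtinctionChiralDescentInfimumDescent`, p134498) reduces the crux to two
statements about the hypothesis' mass-scaling regularisation `reg` and its body up-set
`S = {μ | every tuple above μ carries the body}`:

* OPENNESS (old H1): body above `μ` + ONE lattice rate above `μ` ⇒ body above `μ − δ`;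
* FINITE CHIRAL POINT (H2): body at every tuple ⇒ above some offset no uniform rate.

This file records, definition-free and sorry-free, the bookkeeping a planner needs to PROMOTE that residual content
(both pieces are conjecture class — OS-level chiral gaplessness / light-quark continuation — see the line's cycle
reports):

* `openness_of_gaplessBodyInfimum` / `gaplessBodyInfimum_of_openness`: OPENNESS is classically the same statement as
  GAPLESS INFIMUM (new H1): "if `μ` is the minimum of `S` then no uniform rate holds above `μ`" — Goldstone closure at
  the bottom of the massive phase, the route's foreseen `LocateChiralPoint → GoldstoneClosure` with `μ* = inf S`.
* `chiralPoint_iff_stubs`: (new H1) ∧ H2 ⇔ E, the single statement "if `S` is non-empty it contains an offset without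
  uniform rate" (`0 < N_f`; forward = the landed `exists_threshold_not_gapProp`, backward = monotonicity).
* `chiralDescent_of_gaplessInfimum_of_chiralPointEverywhere`, `chiralDescent_of_chiralPointOfThreshold`: the crux BY
  NAME from (new H1, H2), resp. from E, quantified over `N_f ∈ {2,3}` and all mass-scaling regularisations — one-line
  closers for whichever form is filed.

Pure logic over the landed glue; everything abstract is stated for an arbitrary per-tuple property `P` and rate
predicate `G`, the QCD instances spell the body out verbatim (tree vocabulary only, no `def`).
-/

namespace Summit.QuantumFields.QCD.Cruxes.ChiralDescent.InfimumDescent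

open Filter
open Literature.MathematicalPhysics.QuantumFieldTheory

variable {Nf : ℕ}

/-! ## §1 Openness ⇔ gapless infimum (abstract) -/

/-- **GAPLESS INFIMUM gives OPENNESS**: if (H1) at every minimum `μ` of the up-set `{μ | P above μ}` every rate fails
above `μ`, then `P` above `μ` together with ONE rate above `μ` forces `P` above `μ − δ` for some `δ > 0` — otherwise `μ`
would be such a minimum. [folklore] -/
theorem openness_of_gaplessBodyInfimum (P : (Fin Nf → ℝ) → Prop) (G : ℝ → (Fin Nf → ℝ) → Prop)
    (h1 : ∀ μ : ℝ, (∀ m : Fin Nf → ℝ, (∀ f, μ < m f) → P m) →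
      (∀ μ' < μ, ¬ ∀ m : Fin Nf → ℝ, (∀ f, μ' < m f) → P m) →
      ∀ ε > (0 : ℝ), ∃ m : Fin Nf → ℝ, (∀ f, μ < m f) ∧ ¬ G ε m)
    (μ : ℝ) (hB : ∀ m : Fin Nf → ℝ, (∀ f, μ < m f) → P m)
    (hG : ∃ ε > (0 : ℝ), ∀ m : Fin Nf → ℝ, (∀ f, μ < m f) → G ε m) :
    ∃ δ > (0 : ℝ), ∀ m : Fin Nf → ℝ, (∀ f, μ - δ < m f) → P m := by
  by_contra hno
  push Not at hno
  obtain ⟨ε, hε, hgap⟩ := hG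
  have hmin : ∀ μ' < μ, ¬ ∀ m : Fin Nf → ℝ, (∀ f, μ' < m f) → P m := by
    intro μ' hμ' hall
    obtain ⟨m, hm, hPm⟩ := hno (μ - μ') (sub_pos.mpr hμ')
    exact hPm (hall m fun f => by linarith [hm f])
  obtain ⟨m, hm, hng⟩ := h1 μ hB hmin ε hε
  exact hng (hgap m hm)

/-- **OPENNESS gives GAPLESS INFIMUM** (converse): at a minimum `μ` of the up-set, a uniform rate above `μ` would, by
openness, put `μ − δ` into the up-set. [folklore] -/
theorem gaplessBodyInfimum_of_openness (P : (Fin Nf → ℝ) → Prop) (G : ℝ → (Fin Nf → ℝ) → Prop)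
    (hopen : ∀ μ : ℝ, (∀ m : Fin Nf → ℝ, (∀ f, μ < m f) → P m) →
      (∃ ε > (0 : ℝ), ∀ m : Fin Nf → ℝ, (∀ f, μ < m f) → G ε m) →
      ∃ δ > (0 : ℝ), ∀ m : Fin Nf → ℝ, (∀ f, μ - δ < m f) → P m)
    (μ : ℝ) (hB : ∀ m : Fin Nf → ℝ, (∀ f, μ < m f) → P m)
    (hmin : ∀ μ' < μ, ¬ ∀ m : Fin Nf → ℝ, (∀ f, μ' < m f) → P m) :
    ∀ ε > (0 : ℝ), ∃ m : Fin Nf → ℝ, (∀ f, μ < m f) ∧ ¬ G ε m := by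
  intro ε hε
  by_contra hno
  push Not at hno
  obtain ⟨δ, hδ, hB'⟩ := hopen μ hB ⟨ε, hε, hno⟩
  exact hmin (μ - δ) (by linarith) hB'

/-! ## §2 (H1 ∧ H2) ⇔ E (abstract, `0 < N_f`) -/

/-- **GAPLESS INFIMUM ∧ FINITE CHIRAL POINT ⇔ CHIRAL POINT OF EVERY THRESHOLD.** For a per-tuple property `P`
(`0 < N_f`) and a rate predicate `G`: [(H1) every minimum of the up-set `{μ | P above μ}` has no uniform rate, and (H2)
`P` everywhere gives an offset without uniform rate] iff (E) whenever `P` holds above some `M₁`, some offset `μ` has `P`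
above it and no uniform rate. Forward: the landed infimum descent `exists_threshold_not_gapProp` through
`openness_of_gaplessBodyInfimum`; backward: an E-offset lies at or above any minimum, and "no uniform rate above" is
antitone in the offset. [folklore] -/
theorem chiralPoint_iff_stubs (hNf : 0 < Nf) (P : (Fin Nf → ℝ) → Prop) (G : ℝ → (Fin Nf → ℝ) → Prop) :
    ((∀ μ : ℝ, (∀ m : Fin Nf → ℝ, (∀ f, μ < m f) → P m) →
        (∀ μ' < μ, ¬ ∀ m : Fin Nf → ℝ, (∀ f, μ' < m f) → P m) →
        ∀ ε > (0 : ℝ), ∃ m : Fin Nf → ℝ, (∀ f, μ < m f) ∧ ¬ G ε m) ∧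
      ((∀ m, P m) → ∃ μ : ℝ, ∀ ε > (0 : ℝ), ∃ m : Fin Nf → ℝ, (∀ f, μ < m f) ∧ ¬ G ε m)) ↔
    ∀ M₁ : ℝ, (∀ m : Fin Nf → ℝ, (∀ f, M₁ < m f) → P m) →
      ∃ μ : ℝ, (∀ m : Fin Nf → ℝ, (∀ f, μ < m f) → P m) ∧
        ∀ ε > (0 : ℝ), ∃ m : Fin Nf → ℝ, (∀ f, μ < m f) ∧ ¬ G ε m := by
  constructor
  · rintro ⟨h1, h2⟩ M₁ hM
    obtain ⟨μ, hB, hG⟩ := exists_threshold_not_gapProp hNf P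
      (fun μ => ∃ ε > (0 : ℝ), ∀ m : Fin Nf → ℝ, (∀ f, μ < m f) → G ε m)
      (fun μ hB hG => openness_of_gaplessBodyInfimum P G h1 μ hB hG)
      (fun hall => by
        obtain ⟨μ, hμ⟩ := h2 hall
        refine ⟨μ, ?_⟩
        rintro ⟨ε, hε, hgap⟩
        obtain ⟨m, hm, hng⟩ := hμ ε hε
        exact hng (hgap m hm))
      hM
    refine ⟨μ, hB, fun ε hε => ?_⟩
    by_contra hno
    push Not at hno
    exact hG ⟨ε, hε, hno⟩
  · intro hE
    refine ⟨fun μ hB hmin ε hε => ?_, fun hall => ?_⟩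
    · obtain ⟨μ₀, hB₀, hG₀⟩ := hE μ hB
      have hle : μ ≤ μ₀ := by
        by_contra hlt
        push Not at hlt
        exact hmin μ₀ hlt hB₀
      obtain ⟨m, hm, hng⟩ := hG₀ ε hε
      exact ⟨m, fun f => lt_of_le_of_lt hle (hm f), hng⟩
    · obtain ⟨μ, -, hG⟩ := hE 0 fun m _ => hall m
      exact ⟨μ, hG⟩

/-! ## §3 The crux by name from either promotable form -/

/-- **`ChiralDescent` from GAPLESS INFIMUM (new H1) and FINITE CHIRAL POINT (H2)**, both quantified over `N_f ∈ {2,3}`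
and all mass-scaling regularisations (the two registered stubs `stub_gaplessBodyInfimum`,
`stub_chiralPointOfBodyEverywhere` of the cycle-3 skeleton `Cruxes/ChiralDescent/Lines/Sketch.lean`): H1 is turned into
openness and fed, with H2, to the landed `chiralDescent_of_openness_of_finiteChiralPoint`. CONDITIONAL on H1/H2
(conjecture class). [folklore] -/
theorem chiralDescent_of_gaplessInfimum_of_chiralPointEverywhere
    (h1 : ∀ Nf : ℕ, (Nf = 2 ∨ Nf = 3) → ∀ reg : QCDRegularisation Nf, reg.HasMassScaling → ∀ μ : ℝ,
      (∀ m : Fin Nf → ℝ, (∀ f, μ < m f) →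
        ∃ (z shift : QCDField Nf → ℕ → ℝ) (T : OSData (QCDField Nf) 4),
          IsQCDAlong (reg.scheme m z shift) T ∧ T.IsNontrivial QCDField.glue ∧ T.IsNonGaussian QCDField.glue ∧
            (∀ f g : Fin Nf, f ≠ g → T.IsNontrivial (QCDField.pseudoRe f g)) ∧
              ∃ Δ > 0, T.HasMassGap Δ ∧ (reg.scheme m z shift).HasLatticeMassGap Δ) →
      (∀ μ' < μ, ¬ ∀ m : Fin Nf → ℝ, (∀ f, μ' < m f) →
        ∃ (z shift : QCDField Nf → ℕ → ℝ) (T : OSData (QCDField Nf) 4),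
          IsQCDAlong (reg.scheme m z shift) T ∧ T.IsNontrivial QCDField.glue ∧ T.IsNonGaussian QCDField.glue ∧
            (∀ f g : Fin Nf, f ≠ g → T.IsNontrivial (QCDField.pseudoRe f g)) ∧
              ∃ Δ > 0, T.HasMassGap Δ ∧ (reg.scheme m z shift).HasLatticeMassGap Δ) →
      ∀ ε > (0 : ℝ), ∃ m : Fin Nf → ℝ, (∀ f, μ < m f) ∧ ¬ (reg.scheme m 0 0).HasLatticeMassGap ε)
    (h2 : ∀ Nf : ℕ, (Nf = 2 ∨ Nf = 3) → ∀ reg : QCDRegularisation Nf, reg.HasMassScaling →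
      (∀ m : Fin Nf → ℝ,
        ∃ (z shift : QCDField Nf → ℕ → ℝ) (T : OSData (QCDField Nf) 4),
          IsQCDAlong (reg.scheme m z shift) T ∧ T.IsNontrivial QCDField.glue ∧ T.IsNonGaussian QCDField.glue ∧
            (∀ f g : Fin Nf, f ≠ g → T.IsNontrivial (QCDField.pseudoRe f g)) ∧
              ∃ Δ > 0, T.HasMassGap Δ ∧ (reg.scheme m z shift).HasLatticeMassGap Δ) →
      ∃ μ : ℝ, ∀ ε > (0 : ℝ), ∃ m : Fin Nf → ℝ, (∀ f, μ < m f) ∧ ¬ (reg.scheme m 0 0).HasLatticeMassGap ε) :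
    Summit.QuantumFields.QCD.Theses.SpectralDefectExtinction.ChiralDescent :=
  chiralDescent_of_openness_of_finiteChiralPoint
    (fun Nf hNf reg hMS μ hB hG =>
      openness_of_gaplessBodyInfimum
        (fun m => ∃ (z shift : QCDField Nf → ℕ → ℝ) (T : OSData (QCDField Nf) 4),
          IsQCDAlong (reg.scheme m z shift) T ∧ T.IsNontrivial QCDField.glue ∧ T.IsNonGaussian QCDField.glue ∧
            (∀ f g : Fin Nf, f ≠ g → T.IsNontrivial (QCDField.pseudoRe f g)) ∧
              ∃ Δ > 0, T.HasMassGap Δ ∧ (reg.scheme m z shift).HasLatticeMassGap Δ)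
        (fun ε m => (reg.scheme m 0 0).HasLatticeMassGap ε)
        (h1 Nf hNf reg hMS) μ hB hG)
    h2

/-- **`ChiralDescent` from the single statement E ("every mass-scaling regularisation with a threshold carries the
body above an offset at which it has no uniform lattice rate")**, quantified over `N_f ∈ {2,3}`: the shift of `reg` by
that offset is the witness (`qcdOf_of_bodyAbove_of_noUniformGapAbove`, p134498). By `chiralPoint_iff_stubs`, E for a
regularisation is exactly (new H1 ∧ H2) for it. CONDITIONAL on E (conjecture class). [folklore] -/
theorem chiralDescent_of_chiralPointOfThreshold
    (hE : ∀ Nf : ℕ, (Nf = 2 ∨ Nf = 3) → ∀ reg : QCDRegularisation Nf, reg.HasMassScaling → ∀ M₁ : ℝ,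
      (∀ m : Fin Nf → ℝ, (∀ f, M₁ < m f) →
        ∃ (z shift : QCDField Nf → ℕ → ℝ) (T : OSData (QCDField Nf) 4),
          IsQCDAlong (reg.scheme m z shift) T ∧ T.IsNontrivial QCDField.glue ∧ T.IsNonGaussian QCDField.glue ∧
            (∀ f g : Fin Nf, f ≠ g → T.IsNontrivial (QCDField.pseudoRe f g)) ∧
              ∃ Δ > 0, T.HasMassGap Δ ∧ (reg.scheme m z shift).HasLatticeMassGap Δ) →
      ∃ μ : ℝ, (∀ m : Fin Nf → ℝ, (∀ f, μ < m f) →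
        ∃ (z shift : QCDField Nf → ℕ → ℝ) (T : OSData (QCDField Nf) 4),
          IsQCDAlong (reg.scheme m z shift) T ∧ T.IsNontrivial QCDField.glue ∧ T.IsNonGaussian QCDField.glue ∧
            (∀ f g : Fin Nf, f ≠ g → T.IsNontrivial (QCDField.pseudoRe f g)) ∧
              ∃ Δ > 0, T.HasMassGap Δ ∧ (reg.scheme m z shift).HasLatticeMassGap Δ) ∧
        ∀ ε > (0 : ℝ), ∃ m : Fin Nf → ℝ, (∀ f, μ < m f) ∧ ¬ (reg.scheme m 0 0).HasLatticeMassGap ε) :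
    Summit.QuantumFields.QCD.Theses.SpectralDefectExtinction.ChiralDescent := by
  unfold Summit.QuantumFields.QCD.Theses.SpectralDefectExtinction.ChiralDescent
  rintro Nf hNf ⟨reg, hMS, M₁, -, hbody⟩
  obtain ⟨μ, hB, hG⟩ := hE Nf hNf reg hMS M₁ hbody
  exact qcdOf_of_bodyAbove_of_noUniformGapAbove reg hMS μ hB hG

end Summit.QuantumFields.QCD.Cruxes.ChiralDescent.InfimumDescent
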